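import Mathlib
import HarnessLib.Audit
import Summits.PneNP.PneNP.Theorems.PstarNorUnitDir
import Summits.PneNP.PneNP.Theorems.PstarChordBridgeCorner

/-!
# Tools for the single-(EQ)-chord regime: the parallel coordinate, polar values on output pairs, NOR units with constants (ROUND-24, memo §9 / §13 (P1))

FRONTIER range-avoidance ladder, rung F-N3, ROUND 24 (cell `pnp-ideate`, planner memo `r24/CORE-BOUND-NOTES.md` §9 R5–R8, §13 (P1); restricted-model proof
complexity — nothing here bears on `P` versus `NP`).

For `PstarNorUnitEQ1`: `q_par` — the FIRST coordinate of the basis-changed chord system `mapSys (sys I B) (toX m)` is `q_{m'}` for the partner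
direction `m' = partner m` (`PstarChordBridgeBasis.qDir`, so its polar form is `polarDir I B m'`); `andAdj_iff_mem` / `polarDir_single_pair` — on the
AND pair of an output `j` of the core, `polarDir I B m (e_{a_j}, e_{b_j}) = m₂·[j ∈ T₁] + m₁·[j ∈ T₂]` (simple overlaps; pendants off the core);
`nor_unit_of_dir_const` — `PstarNorUnitDir.nor_unit_of_dir` with arbitrary additive constants (`q_m = λ_b·λ_a + ζ`, `Q + c = (λ_b+1)m₁ + (λ_a+1)m₂`):
the proof only uses the polar identity, which ignores constants.
-/

set_option linter.dupNamespace false -- `Summit.PneNP.PneNP.…`: summit = sub-problem name (D-0017 single-conjunct layout)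

open Finset Module Literature.Computability.Complexity
open Summit.PneNP.PneNP.Theorems.PstarSALevel (varSet bdry BoundaryExpanding SimpleOverlap)
open Summit.PneNP.PneNP.Theorems.PstarGapLinearised (andPair andPair_subset_varSet)
open Summit.PneNP.PneNP.Theorems.PstarChordEndgameTools (mem_andPair_iff)
open Summit.PneNP.PneNP.Theorems.PstarCentreFree (vars_mem_varSet)
open Summit.PneNP.PneNP.Theorems.PstarCubeIdeals (IsAffineFn)
open Summit.PneNP.PneNP.Theorems.PstarQuadRank (rad)
open Summit.PneNP.PneNP.Theorems.PstarRankRigidityTwo (linPart symForm symForm_apply linPart_apply affine_mul_polar)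
open Summit.PneNP.PneNP.Theorems.PstarForcing (polar_unique)
open Summit.PneNP.PneNP.Theorems.PstarProductRank (qform polar)
open Summit.PneNP.PneNP.Theorems.PstarPathRank (AndAdj polar_basis)
open Summit.PneNP.PneNP.Theorems.PstarChordSystem (ChordSystem)
open Summit.PneNP.PneNP.Theorems.PstarChordSystemMap (mapSys toX partner mapSys_F mapSys_t)
open Summit.PneNP.PneNP.Theorems.PstarChordBridge (BridgeData sys sys_F sys_t)
open Summit.PneNP.PneNP.Theorems.PstarReadSumset (V2)
open Summit.PneNP.PneNP.Theorems.PstarChordBridgeForcing (freeMon freePolar rank_four_of_wf)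
open Summit.PneNP.PneNP.Theorems.PstarChordBridgeBasis (qDir polarDir q_dir q_dir_add)
open Summit.PneNP.PneNP.Theorems.PstarNorUnitCases (mem_of_andAdj)
open Summit.PneNP.PneNP.Theorems.PstarNorUnitNA (nor_unit_na)
open Summit.PneNP.PneNP.Theorems.PstarNorUnitBridge (xor_not_mem_bdry_of_even)
open Summit.PneNP.PneNP.Theorems.PstarNorUnitDir (exists_realiser_of_polarDir)
open Summit.PneNP.PneNP.Theorems.PstarChordBridgeCorner (andAdj_iff_mem qDir_add)

namespace Summit.PneNP.PneNP.Theorems.PstarNorUnitEQ1Tools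

variable {n m : ℕ}

/-! ## The parallel coordinate -/

/-- The first coordinate after the basis change is the pairing with the partner direction. -/
theorem toX_fst (mv v : V2) : (toX mv v).1 = v.1 * (partner mv).2 + v.2 * (partner mv).1 := rfl

/-- **The basis-changed FIRST constraint is `q_{m'}`** for `m' = partner m`. -/
theorem q_par (I : LocalMap 4 n m) (B : BridgeData n m) (mv : V2) (x : Fin n → ZMod 2) :
    ((mapSys (sys I B) (toX mv)).F x).1 + (mapSys (sys I B) (toX mv)).t.1 = qDir I B (partner mv) x := by
  rw [mapSys_F, mapSys_t, toX_fst, toX_fst, sys_F, sys_t]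
  unfold PstarChordBridgeBasis.qDir
  simp only
  ring

/-! ## Polar values on the AND pair of an output -/

/-- **`polarDir` on the AND pair of a core output**: `polarDir I B m (e_{a_j}, e_{b_j}) = m₂·[j ∈ T₁] + m₁·[j ∈ T₂]` for `j ∈ J₀` when the
pendant sets are disjoint from `J₀`. -/
theorem polarDir_single_pair (I : LocalMap 4 n m) (hI : I.IsPure xorAndPred) (hS : SimpleOverlap I) {B : BridgeData n m}
    (hG₁ : Disjoint B.G₁ B.J₀) (hG₂ : Disjoint B.G₂ B.J₀) (mv : V2) {j : Fin m} (hj : j ∈ B.J₀) :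
    polarDir I B mv (Pi.single (I.vars j 2) 1) (Pi.single (I.vars j 3) 1) =
      mv.2 * (if j ∈ B.T₁ then 1 else 0) + mv.1 * (if j ∈ B.T₂ then 1 else 0) := by
  classical
  have hfm : ∀ G : Finset (Fin m), Disjoint G B.J₀ → ¬ AndAdj I (freeMon I B.N G) (I.vars j 2) (I.vars j 3) := by
    intro G hG h
    rw [andAdj_iff_mem I hI hS] at h
    exact Finset.disjoint_left.1 hG (mem_filter.1 h).1 hj
  unfold PstarChordBridgeBasis.polarDir PstarChordBridgeForcing.freePolar
  rw [LinearMap.add_apply, LinearMap.add_apply, LinearMap.smul_apply, LinearMap.smul_apply, LinearMap.smul_apply, LinearMap.smul_apply,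
    LinearMap.add_apply, LinearMap.add_apply, LinearMap.add_apply, LinearMap.add_apply,
    polar_basis I hI hS, polar_basis I hI hS, polar_basis I hI hS, polar_basis I hI hS, if_neg (hfm B.G₁ hG₁), if_neg (hfm B.G₂ hG₂),
    add_zero, add_zero, smul_eq_mul, smul_eq_mul]
  simp only [andAdj_iff_mem I hI hS]

/-! ## NOR units with constants -/

/-- **`nor_unit_of_dir` with arbitrary constants**: `q_m = (λ_b)(λ_a) + ζ` and `Q_{D e} + c = (λ_b+1)m₁ + (λ_a+1)m₂` (any `ζ, c`) give the same
CONS-T unit — the proof of `PstarNorUnitDir.nor_unit_of_dir` verbatim (only the polar identity of `q_m` is used). -/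
theorem nor_unit_of_dir_const (I : LocalMap 4 n m) (hI : I.IsPure xorAndPred) (hS : SimpleOverlap I) {r : ℕ} (hB : BoundaryExpanding r I)
    {B : BridgeData n m} (hW : B.WF I) (hr : (B.J₀ ∪ B.G₁ ∪ B.G₂).card ≤ r) {e : Fin m} (he : e ∈ B.N) (heG : e ∉ B.G₁ ∪ B.G₂) (mv : V2)
    {a b : Fin n → ZMod 2} {β α ζ : ZMod 2}
    (hq : ∀ x, qDir I B mv x = (polarDir I B mv x b + β) * (polarDir I B mv x a + α) + ζ)
    {m₁ m₂ : (Fin n → ZMod 2) → ZMod 2} (hm₁ : IsAffineFn m₁) (hm₂ : IsAffineFn m₂) {c : ZMod 2}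
    (hQ : ∀ x, qform (B.D e) (fun j => I.vars j 2) (fun j => I.vars j 3) x + c =
      (polarDir I B mv x b + β + 1) * m₁ x + (polarDir I B mv x a + α + 1) * m₂ x) :
    ∃ j₁ j₂ : Fin m, ∃ σ τ : Fin n, j₁ ≠ j₂ ∧ B.D e = {j₁, j₂} ∧ Disjoint (andPair I j₁) (andPair I j₂) ∧ σ ∈ andPair I j₁ ∧ τ ∈ andPair I j₂ ∧
      (∀ v : Fin n, (polarDir I B mv (Pi.single v 1) b ≠ 0 ∨ polarDir I B mv (Pi.single v 1) a ≠ 0) ↔ (v = σ ∨ v = τ)) ∧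
      ∃ g ∈ B.T₁ ∪ freeMon I B.N B.G₁ ∪ (B.T₂ ∪ freeMon I B.N B.G₂), σ ∈ andPair I g ∧ τ ∈ andPair I g := by
  classical
  set fP := polarDir I B mv with hfP
  have haff : ∀ (y : Fin n → ZMod 2) (k : ZMod 2), IsAffineFn (fun x => fP x y + k) := by
    intro y k x w
    show fP (x + w) y + k = fP x y + k + (fP w y + k) + (fP 0 y + k)
    rw [map_add, LinearMap.add_apply, map_zero, LinearMap.zero_apply, zero_add]
    generalize fP x y = s; generalize fP w y = t
    revert s t k; decide
  have hμ₁ : IsAffineFn (fun x => fP x b + (β + 1)) := haff b (β + 1)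
  have hμ₂ : IsAffineFn (fun x => fP x a + (α + 1)) := haff a (α + 1)
  have hlb : IsAffineFn (fun x => fP x b + β) := haff b β
  have hla : IsAffineFn (fun x => fP x a + α) := haff a α
  have e3 : ∀ s k : ZMod 2, s + k + k = s := by decide
  have lin : ∀ {y : Fin n → ZMod 2} {k : ZMod 2} (h : IsAffineFn (fun x => fP x y + k)) (x : Fin n → ZMod 2), linPart h x = fP x y := by
    intro y k h x
    rw [linPart_apply]
    show fP x y + k + (fP 0 y + k) = fP x y
    rw [map_zero, LinearMap.zero_apply, zero_add]
    exact e3 _ _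
  have hQ' : ∀ x, qform (B.D e) (fun j => I.vars j 2) (fun j => I.vars j 3) x + c =
      (fun x => fP x b + (β + 1)) x * m₁ x + (fun x => fP x a + (α + 1)) x * m₂ x := by
    intro x; rw [hQ x]; simp only [add_assoc]
  have hqB : ∀ x w, qDir I B mv (x + w) = qDir I B mv x + qDir I B mv w + qDir I B mv 0 + fP x w := qDir_add I B mv
  have hpol : fP = symForm (linPart hlb) (linPart hla) := by
    refine polar_unique (Q := qDir I B mv) hqB fun x w => ?_
    rw [hq, hq x, hq w, hq 0, affine_mul_polar hlb hla]
    generalize (fP x b + β) * (fP x a + α) = s; generalize (fP w b + β) * (fP w a + α) = s'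
    generalize (fP 0 b + β) * (fP 0 a + α) = s₀; generalize symForm (linPart hlb) (linPart hla) x w = t
    generalize ζ = k
    revert s s' s₀ t k; decide
  set G : Finset (Fin m) := (B.T₁ ∪ freeMon I B.N B.G₁ ∪ (B.T₂ ∪ freeMon I B.N B.G₂)).filter fun g => g ∉ insert e (B.D e) with hGdef
  have heD : e ∉ B.D e := fun h => (mem_sdiff.1 (hW.hD e he h)).2 he
  have hGd : Disjoint G (insert e (B.D e)) := by
    rw [Finset.disjoint_left]
    intro g hg
    exact (mem_filter.1 hg).2
  have hsub : insert e (B.D e) ∪ G ⊆ B.J₀ ∪ B.G₁ ∪ B.G₂ := by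
    intro g hg
    rcases mem_union.1 hg with hg | hg
    · rcases mem_insert.1 hg with rfl | hg
      · exact mem_union_left _ (mem_union_left _ (hW.hN he))
      · exact mem_union_left _ (mem_union_left _ (mem_sdiff.1 (hW.hD e he hg)).1)
    · have hg' := (mem_filter.1 hg).1
      rcases mem_union.1 hg' with hg' | hg' <;> rcases mem_union.1 hg' with hg' | hg'
      · exact mem_union_left _ (mem_union_left _ (mem_sdiff.1 (hW.hT₁ hg')).1)
      · exact mem_union_left _ (mem_union_right _ (mem_filter.1 hg').1)
      · exact mem_union_left _ (mem_union_left _ (mem_sdiff.1 (hW.hT₂ hg')).1)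
      · exact mem_union_right _ (mem_filter.1 hg').1
  have hr' : (insert e (B.D e) ∪ G).card ≤ r := (card_le_card hsub).trans hr
  have hcyc := xor_not_mem_bdry_of_even I hI (hW.hDeven e he)
  have hrank := rank_four_of_wf I hI hS hB hW ((card_le_card (subset_union_left.trans subset_union_left)).trans hr) he
  have hK : ∀ v w : Fin n, v ≠ w → ¬ AndAdj I (B.D e) v w →
      linPart hμ₁ (Pi.single v 1) * linPart hμ₂ (Pi.single w 1) + linPart hμ₁ (Pi.single w 1) * linPart hμ₂ (Pi.single v 1) = 1 →
        ∃ g ∈ G, v ∈ andPair I g ∧ w ∈ andPair I g := by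
    intro v w hvw hna hdet
    rw [lin hμ₁, lin hμ₁, lin hμ₂, lin hμ₂] at hdet
    have hval : fP (Pi.single v 1) (Pi.single w 1) = 1 := by
      rw [hpol, symForm_apply, lin hlb, lin hlb, lin hla, lin hla]
      exact hdet
    rw [hfP] at hval
    obtain ⟨g, hg, hvg, hwg⟩ := exists_realiser_of_polarDir I hI hS B mv hval
    refine ⟨g, mem_filter.2 ⟨hg, fun hge => ?_⟩, hvg, hwg⟩
    rcases mem_insert.1 hge with rfl | hgD
    · rcases mem_union.1 hg with h | h <;> rcases mem_union.1 h with h | h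
      · exact (mem_sdiff.1 (hW.hT₁ h)).2 he
      · exact heG (mem_union_left _ (mem_filter.1 h).1)
      · exact (mem_sdiff.1 (hW.hT₂ h)).2 he
      · exact heG (mem_union_right _ (mem_filter.1 h).1)
    · refine hna ?_
      rw [mem_andPair_iff] at hvg hwg
      rcases hvg with rfl | rfl <;> rcases hwg with rfl | rfl
      · exact absurd rfl hvw
      · exact ⟨g, hgD, Or.inl ⟨rfl, rfl⟩⟩
      · exact ⟨g, hgD, Or.inr ⟨rfl, rfl⟩⟩
      · exact absurd rfl hvw
  obtain ⟨j₁, j₂, σ, τ, hne, hDe, hdisj, hσ, hτ, hlit, g, hg, hσg, hτg⟩ :=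
    nor_unit_na hI hS hB heD hGd hr' hcyc hμ₁ hμ₂ hm₁ hm₂ hQ' hK hrank
  refine ⟨j₁, j₂, σ, τ, hne, hDe, hdisj, hσ, hτ, fun v => ?_, g, (mem_filter.1 hg).1, hσg, hτg⟩
  rw [← hlit v, lin hμ₁, lin hμ₂]

end Summit.PneNP.PneNP.Theorems.PstarNorUnitEQ1Tools
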